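import Mathlib
import HarnessLib
import Summits.Ventures.LatticeQCDFlow.Exactness.NCMCGeneralSpaceIntervalCoverage
import Summits.Ventures.LatticeQCDFlow.Exactness.NCMCGeneralSpaceOccupancyChainCLT

/-!
# The REPORTED `dF_occ` interval of the NCMC lane has asymptotic coverage `N(0, τ_int/τ̄)([−z, z])`, at least nominal with any `τ̄ ≥ τ_int(ρ_occ)` — in particular with GEN-18's certified `τ̄ = 1/2 + (2/ε − 1)/(1 − σ)` — from EVERY initial state

HONEST FRAMING: exact (Metropolis-corrected) sampling algorithms for lattice gauge theory;
figures of merit are autocorrelation/cost numbers at stated couplings and volumes; no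
continuum-physics claim.

Venture `LatticeQCDFlow` (cell pub-lqcd), topic `Exactness`; FANOUT row 13 (`eng-snf`, GEN-19).
NEW WORK of the cell, not a published result; no definition is introduced; nothing is cited as a
fact.  ASSEMBLY of GEN-19's plug-in coverage lemma (`NCMCGeneralSpaceIntervalCoverage`:
`tendsto_measure_abs_mul_le_of_clt`, `nominal_le_coverage_limit_of_le`), the NCMC `dF_occ` CLT
(`NCMCGeneralSpaceOccupancyChainCLT`: `CrooksPair.ncmc_dFocc_clt_of_sq`), GEN-18's every-start law of
large numbers for the occupancy (`CrooksPair.ncmc_occupancy_everyStart_of_sq`) and GEN-18's CERTIFIED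
bound `τ_int(ρ_occ) ≤ 1/2 + (2/ε − 1)/(1 − σ)` (`CrooksPair.ncmc_tauInt_occupancy_le_of_sq`).
Engine (`latflow-snf`, `correction = ncmc-metropolis`): what `run_ncmc_chain` REPORTS is
`dF_occ ± z · √(2 τ̄ / (n p̂(1 − p̂)))` with `p̂` the occupancy and `τ̄` a number for the integrated
autocorrelation time of the occupancy indicator.

## Content (Crooks pair, level samplers leaving `ν₀`, `ν₁` invariant, `ε • ν ≤ nHit Q 2 z` (`ε ≠ 0`),
## `e^{−ΔF} = Z₁/Z₀`, `σ = σ(c − ΔF)`, `ρ_occ = setACF Q π_c target`, `τ_int = Scoring.tauInt ρ_occ`)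

* **`CrooksPair.ncmc_dFocc_coverage_of_sq`** — for every initial state `z₀`, `τ̄ > 0`, `z > 0`:
  `P_{δ_{z₀}}{ |√n (dF_occ,n − ΔF) · √(p̂_n(1 − p̂_n)/(2 τ̄))| ≤ z } → gaussianReal 0 (τ_int/τ̄) (Icc (−z) z)`
  (the event IS "`ΔF ∈ dF_occ,n ± z √(2τ̄/(n p̂_n(1 − p̂_n)))`" whenever `0 < p̂_n < 1`).
* **`CrooksPair.ncmc_dFocc_coverage_nominal_of_le`** — if `τ_int ≤ τ̄` that limit is
  `≥ gaussianReal 0 1 (Icc (−z) z)`: asymptotic coverage at least nominal;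
  **`CrooksPair.ncmc_dFocc_coverage_certified`** — with GEN-18's certified
  `τ̄ = 1/2 + (2/ε − 1)/(1 − σ)` the limit coverage is `≥ gaussianReal 0 1 (Icc (−z) z)` unconditionally.

NOT CLAIMED: a consistent estimator of `τ_int(ρ_occ)` (with it, coverage would be exactly nominal);
finite-`n` coverage; the value of `ε` for a concrete protocol (astronomically small — the certified
interval is honest but wide; the measured `τ_int` stays the figure of merit).
-/

namespace Summit.Ventures.LatticeQCDFlow.Exactness.GeneralNCMC

open MeasureTheory ProbabilityTheory Set Filter Finset
open scoped ENNReal NNReal Topology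

section NCMC

variable {Ω E : Type*} [MeasurableSpace Ω] [MeasurableSpace E]
  {ν₀ ν₁ : Measure Ω} [IsFiniteMeasure ν₀] [IsFiniteMeasure ν₁]
  {κF κR : Kernel Ω E} [IsMarkovKernel κF] [IsMarkovKernel κR] {s e : E → Ω} {W : E → ℝ} {c : ℝ}
  {T₀ T₁ : Kernel Ω Ω} [IsMarkovKernel T₀] [IsMarkovKernel T₁] {ε : ℝ≥0∞}
  {ν : Measure (Bool × Ω)} [IsProbabilityMeasure ν]

/-- **ASYMPTOTIC COVERAGE OF THE REPORTED `dF_occ` INTERVAL, FROM EVERY INITIAL STATE.**  Under a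
two-step minorisation `ε • ν ≤ (nHit Q 2)(z, ·)` (`ε ≠ 0`): for every initial state `z₀`, every
`τ̄ > 0` and `z > 0`,
`P_{δ_{z₀}}{|√n (dF_occ,n − ΔF) · √(p̂_n(1 − p̂_n)/(2τ̄))| ≤ z} → gaussianReal 0 (τ_int(ρ_occ)/τ̄) (Icc (−z) z)`. -/
theorem CrooksPair.ncmc_dFocc_coverage_of_sq (h : CrooksPair ν₀ ν₁ κF κR s e W)
    (h0 : ν₀ univ ≠ 0) (h1 : ν₁ univ ≠ 0) (hT₀ : Kernel.Invariant T₀ ν₀)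
    (hT₁ : Kernel.Invariant T₁ ν₁) (hε : ε ≠ 0)
    (hD : haveI := isMarkovKernel_switchKernel (κF := κF) (κR := κR) (c := c)
              h.measurable_W h.measurable_s h.measurable_e
      ∀ z, ε • ν ≤ nHit (switchKernel κF κR c W s e ∘ₖ levelKernel T₀ T₁) 2 z)
    {ΔF : ℝ} (hΔF : Real.exp (-ΔF) = ((ν₀ univ)⁻¹ * ν₁ univ).toReal) (z₀ : Bool × Ω)
    {τbar : ℝ} (hτ : 0 < τbar) {z : ℝ} (hz : 0 < z)
    [hP : haveI := isMarkovKernel_switchKernel (κF := κF) (κR := κR) (c := c)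
              h.measurable_W h.measurable_s h.measurable_e
      haveI := isMarkovKernel_levelKernel T₀ T₁
      IsProbabilityMeasure (Kernel.trajMeasure (X := fun _ : ℕ => Bool × Ω) (Measure.dirac z₀)
        (fun n : ℕ => (switchKernel κF κR c W s e ∘ₖ levelKernel T₀ T₁).comap
          (fun hh : (j : ↥(Finset.Iic n)) → Bool × Ω => hh ⟨n, Finset.mem_Iic.2 le_rfl⟩)
          (measurable_pi_apply _)))] :
    haveI := isMarkovKernel_switchKernel (κF := κF) (κR := κR) (c := c)
      h.measurable_W h.measurable_s h.measurable_e
    haveI := isMarkovKernel_levelKernel T₀ T₁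
    Tendsto (fun n : ℕ => (Kernel.trajMeasure (X := fun _ : ℕ => Bool × Ω) (Measure.dirac z₀)
        (fun n : ℕ => (switchKernel κF κR c W s e ∘ₖ levelKernel T₀ T₁).comap
          (fun hh : (j : ↥(Finset.Iic n)) → Bool × Ω => hh ⟨n, Finset.mem_Iic.2 le_rfl⟩)
          (measurable_pi_apply _)))
        {x : ℕ → Bool × Ω | |Real.sqrt n * ((c - Real.log
            ((∑ i ∈ range n, (targetLevel Ω).indicator (1 : Bool × Ω → ℝ) (x i)) / n /
              (1 - (∑ i ∈ range n, (targetLevel Ω).indicator (1 : Bool × Ω → ℝ) (x i)) / n)))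
            - ΔF)
          * Real.sqrt ((∑ i ∈ range n, (targetLevel Ω).indicator (1 : Bool × Ω → ℝ) (x i)) / n
            * (1 - (∑ i ∈ range n, (targetLevel Ω).indicator (1 : Bool × Ω → ℝ) (x i)) / n)
            / (2 * τbar))| ≤ z})
      atTop (𝓝 (gaussianReal 0 (Real.toNNReal
        (Scoring.tauInt (setACF (switchKernel κF κR c W s e ∘ₖ levelKernel T₀ T₁)
            ((jointWeight c ν₀ ν₁ univ)⁻¹ • jointWeight c ν₀ ν₁) (targetLevel Ω)) / τbar))
        (Icc (-z) z))) := by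
  haveI := isMarkovKernel_switchKernel (κF := κF) (κR := κR) (c := c)
    h.measurable_W h.measurable_s h.measurable_e
  haveI := isMarkovKernel_levelKernel T₀ T₁
  set τ : ℝ := Scoring.tauInt (setACF (switchKernel κF κR c W s e ∘ₖ levelKernel T₀ T₁)
    ((jointWeight c ν₀ ν₁ univ)⁻¹ • jointWeight c ν₀ ν₁) (targetLevel Ω)) with hτdef
  set σ : ℝ := Real.sigmoid (c - ΔF) with hσdef
  have hσ0 : 0 < σ := Real.sigmoid_pos _
  have hσ1 : σ < 1 := Real.sigmoid_lt_one _
  have hv0 : 0 < σ * (1 - σ) := mul_pos hσ0 (sub_pos.2 hσ1)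
  -- the `dF_occ` CLT with the canonical Gaussian variable
  have hclt := h.ncmc_dFocc_clt_of_sq h0 h1 hT₀ hT₁ hε hD hΔF z₀
    (P' := gaussianReal 0 (Real.toNNReal (2 * τ / (σ * (1 - σ))))) (Y := id) HasLaw.id
  -- the plug-in scale `√(p̂(1 − p̂)/(2τ̄)) → √(σ(1 − σ)/(2τ̄))` almost surely
  have h1m : Measurable ((targetLevel Ω).indicator (1 : Bool × Ω → ℝ)) :=
    measurable_one.indicator measurableSet_targetLevel
  have hpm : ∀ n : ℕ, Measurable fun x : ℕ → Bool × Ω =>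
      (∑ i ∈ range n, (targetLevel Ω).indicator (1 : Bool × Ω → ℝ) (x i)) / n := fun n =>
    (Finset.measurable_sum _ fun i _ => h1m.comp (measurable_pi_apply i)).div_const _
  have hBm : ∀ n : ℕ, Measurable fun x : ℕ → Bool × Ω =>
      Real.sqrt ((∑ i ∈ range n, (targetLevel Ω).indicator (1 : Bool × Ω → ℝ) (x i)) / n
        * (1 - (∑ i ∈ range n, (targetLevel Ω).indicator (1 : Bool × Ω → ℝ) (x i)) / n)
        / (2 * τbar)) := fun n =>
    (((hpm n).mul (measurable_const.sub (hpm n))).div_const _).sqrt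
  have hB := h.ncmc_occupancy_everyStart_of_sq h0 h1 hT₀ hT₁ hε hD hΔF z₀
  have hB' : ∀ᵐ x ∂(Kernel.trajMeasure (X := fun _ : ℕ => Bool × Ω) (Measure.dirac z₀)
      (fun n : ℕ => (switchKernel κF κR c W s e ∘ₖ levelKernel T₀ T₁).comap
        (fun hh : (j : ↥(Finset.Iic n)) → Bool × Ω => hh ⟨n, Finset.mem_Iic.2 le_rfl⟩)
        (measurable_pi_apply _))),
      Tendsto (fun n : ℕ => Real.sqrt
        ((∑ i ∈ range n, (targetLevel Ω).indicator (1 : Bool × Ω → ℝ) (x i)) / n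
          * (1 - (∑ i ∈ range n, (targetLevel Ω).indicator (1 : Bool × Ω → ℝ) (x i)) / n)
          / (2 * τbar))) atTop (𝓝 (Real.sqrt (σ * (1 - σ) / (2 * τbar)))) := by
    filter_upwards [hB] with x hx
    exact ((hx.mul (tendsto_const_nhds.sub hx)).div_const (2 * τbar)).sqrt
  have hcov := tendsto_measure_abs_mul_le_of_clt hBm HasLaw.id hclt hB' hz
  have hnn : NNReal.mk ((Real.sqrt (σ * (1 - σ) / (2 * τbar))) ^ 2) (sq_nonneg _)
      * (2 * τ / (σ * (1 - σ))).toNNReal = (τ / τbar).toNNReal := by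
    rw [show NNReal.mk ((Real.sqrt (σ * (1 - σ) / (2 * τbar))) ^ 2) (sq_nonneg _)
        = (σ * (1 - σ) / (2 * τbar)).toNNReal by
          apply NNReal.eq
          rw [NNReal.coe_mk, Real.coe_toNNReal _ (by positivity), Real.sq_sqrt (by positivity)],
      ← Real.toNNReal_mul (by positivity)]
    congr 1
    have h2 : σ ≠ 0 := hσ0.ne'
    have h3 : 1 - σ ≠ 0 := (sub_pos.2 hσ1).ne'
    have h4 : τbar ≠ 0 := hτ.ne'
    field_simp
  rw [hnn] at hcov
  exact hcov

omit [IsFiniteMeasure ν₀] [IsFiniteMeasure ν₁] in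
/-- **Asymptotic coverage is at least nominal whenever `τ̄ ≥ τ_int(ρ_occ)`** (`z ≥ 0`). -/
theorem CrooksPair.ncmc_dFocc_coverage_nominal_of_le (h : CrooksPair ν₀ ν₁ κF κR s e W)
    {T₀ T₁ : Kernel Ω Ω} {τbar : ℝ} (hτ : 0 < τbar)
    (hle : haveI := isMarkovKernel_switchKernel (κF := κF) (κR := κR) (c := c)
              h.measurable_W h.measurable_s h.measurable_e
      Scoring.tauInt (setACF (switchKernel κF κR c W s e ∘ₖ levelKernel T₀ T₁)
        ((jointWeight c ν₀ ν₁ univ)⁻¹ • jointWeight c ν₀ ν₁) (targetLevel Ω)) ≤ τbar)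
    {z : ℝ} (hz : 0 ≤ z) :
    haveI := isMarkovKernel_switchKernel (κF := κF) (κR := κR) (c := c)
      h.measurable_W h.measurable_s h.measurable_e
    gaussianReal 0 1 (Icc (-z) z) ≤ gaussianReal 0 (Real.toNNReal
      (Scoring.tauInt (setACF (switchKernel κF κR c W s e ∘ₖ levelKernel T₀ T₁)
          ((jointWeight c ν₀ ν₁ univ)⁻¹ • jointWeight c ν₀ ν₁) (targetLevel Ω)) / τbar))
      (Icc (-z) z) :=
  nominal_le_coverage_limit_of_le hτ hle hz

/-- **WITH GEN-18's CERTIFIED `τ̄ = 1/2 + (2/ε − 1)/(1 − σ)` THE LIMIT COVERAGE IS AT LEAST NOMINAL**,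
unconditionally (the certificate itself bounds `τ_int(ρ_occ)`). -/
theorem CrooksPair.ncmc_dFocc_coverage_certified (h : CrooksPair ν₀ ν₁ κF κR s e W)
    (h0 : ν₀ univ ≠ 0) (h1 : ν₁ univ ≠ 0) (hT₀ : Kernel.Invariant T₀ ν₀)
    (hT₁ : Kernel.Invariant T₁ ν₁) (hε : ε ≠ 0)
    (hD : haveI := isMarkovKernel_switchKernel (κF := κF) (κR := κR) (c := c)
              h.measurable_W h.measurable_s h.measurable_e
      ∀ z, ε • ν ≤ nHit (switchKernel κF κR c W s e ∘ₖ levelKernel T₀ T₁) 2 z)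
    {ΔF : ℝ} (hΔF : Real.exp (-ΔF) = ((ν₀ univ)⁻¹ * ν₁ univ).toReal) {z : ℝ} (hz : 0 ≤ z) :
    haveI := isMarkovKernel_switchKernel (κF := κF) (κR := κR) (c := c)
      h.measurable_W h.measurable_s h.measurable_e
    haveI := isMarkovKernel_levelKernel T₀ T₁
    gaussianReal 0 1 (Icc (-z) z) ≤ gaussianReal 0 (Real.toNNReal
      (Scoring.tauInt (setACF (switchKernel κF κR c W s e ∘ₖ levelKernel T₀ T₁)
          ((jointWeight c ν₀ ν₁ univ)⁻¹ • jointWeight c ν₀ ν₁) (targetLevel Ω))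
        / (1 / 2 + (2 / ε.toReal - 1) / (1 - Real.sigmoid (c - ΔF))))) (Icc (-z) z) := by
  haveI := isMarkovKernel_switchKernel (κF := κF) (κR := κR) (c := c)
    h.measurable_W h.measurable_s h.measurable_e
  haveI := isMarkovKernel_levelKernel T₀ T₁
  have hle := h.ncmc_tauInt_occupancy_le_of_sq h0 h1 hT₀ hT₁ hε hD hΔF
  -- the certified `τ̄` is positive: `ε ≤ 1` so `2/ε − 1 ≥ 1`, and `1 − σ > 0`
  obtain ⟨x0, -⟩ := nonempty_of_measure_ne_zero h0
  haveI : Nonempty (Bool × Ω) := ⟨(false, x0)⟩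
  haveI := isMarkovKernel_nHit (switchKernel κF κR c W s e ∘ₖ levelKernel T₀ T₁) 2
  have hε1 : ε ≤ 1 := eps_le_one_of_minorised hD
  have hεtop : ε ≠ ∞ := ne_top_of_le_ne_top ENNReal.one_ne_top hε1
  have hεpos : 0 < ε.toReal := ENNReal.toReal_pos hε hεtop
  have hεr1 : ε.toReal ≤ 1 := by
    have := ENNReal.toReal_mono ENNReal.one_ne_top hε1
    rwa [ENNReal.toReal_one] at this
  have h2 : 1 ≤ 2 / ε.toReal - 1 := by
    rw [le_sub_iff_add_le, le_div_iff₀ hεpos]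
    linarith
  have hσ1 : 0 < 1 - Real.sigmoid (c - ΔF) := sub_pos.2 (Real.sigmoid_lt_one _)
  have hτ : 0 < 1 / 2 + (2 / ε.toReal - 1) / (1 - Real.sigmoid (c - ΔF)) := by positivity
  exact nominal_le_coverage_limit_of_le hτ hle hz

end NCMC

end Summit.Ventures.LatticeQCDFlow.Exactness.GeneralNCMC
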